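import Mathlib
import Summits.HodgeConjecture.HodgeConjecture.Theorems.SoloBlindE13LocalConstancy

/-!
# SoloBlind — E13 isotropic lines (LEMMA ISO8, solo-blind HodgeConjecture, s139)

Structure lemma for the satellite schemes `V_{τ,δ} = {F_a = F_b = 0}` of the critical stratum
`e = 1/3` (notation of `SoloBlindE13LocalConstancy`: `Fa`, `Fb` in the K-plane coordinates `(a, b)`,
`d_K = (d₁, d₂, -d₁-d₂)`, unit parameter `τ`).

On an ARTIN–SCHREIER EIGENLINE `a = ω b` with `ω² + ω + 1 = 0` (the two isotropic lines of the norm form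
`a² + ab + b²`), the two satellite equations become PROPORTIONAL in characteristic `5`:
`F_a(ωb, b) = ω² · F_b(ωb, b)` (`Fa_eq_omega_sq_mul_Fb`), and `F_b(ωb, b) = b · (4b⁴ − 2τb + E_b(δ))` with
`E_b(δ) = (d₁ + 3d₂)ω + (3d₁ + 2d₂)` (`Fb_on_eigenline`).  Hence for EVERY `(τ, δ)` the scheme `V_{τ,δ}`
meets each eigenline in the origin and the four roots of the quartic `4b⁴ − 2τb + E_b(δ)`: `4 + 4` of the
`25` satellites always lie on the two eigenlines (LEMMA ISO8 of work/s139/e13.md §13, an input of the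
classification THEOREM E13-SAT).  Both statements are `ring`/`linear_combination` identities with explicit
integer certificates; Mathlib + the landed module only; no `sorry`.
-/

namespace Summit.HodgeConjecture.HodgeConjecture.Theorems.SoloBlindE13Isotropic

open Summit.HodgeConjecture.HodgeConjecture.Theorems.SoloBlindE13LocalConstancy

variable {R : Type*} [CommRing R]

/-- Integral certificate: `F_a(ωb,b) − ω²F_b(ωb,b) = q·(ω²+ω+1) + 5·s` with explicit `q`, `s`. -/
theorem Fa_sub_omega_sq_Fb_int (ω b d₁ d₂ τ : R) :
    Fa (ω*b) b d₁ d₂ τ - ω^2 * Fb (ω*b) b d₁ d₂ τ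
      = (b*d₂ - 2*b*d₁ + 3*b^2*τ - 3*ω*b*d₂ - ω*b*d₁ - 3*ω^2*b^2*τ - 4*ω^2*b^5 + 4*ω^3*b^5)
          * (ω^2 + ω + 1)
        + 5 * (b*d₁ + ω*b*d₂ + ω*b*d₁) := by
  unfold Fa Fb; ring

/-- On the eigenline `a = ωb`: `F_b(ωb,b) = b·(4b⁴ − 2τb + E_b(δ)) + 3τb²·(ω²+ω+1)` (any commutative ring). -/
theorem Fb_on_eigenline_int (ω b d₁ d₂ τ : R) :
    Fb (ω*b) b d₁ d₂ τ
      = b * (4*b^4 - 2*τ*b + ((d₁ + 3*d₂)*ω + (3*d₁ + 2*d₂))) + 3*τ*b^2*(ω^2 + ω + 1) := by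
  unfold Fb; ring

/-- LEMMA ISO8 (a): in characteristic `5`, on an eigenline `a = ωb` (`ω² + ω + 1 = 0`) the first satellite
equation is `ω²` times the second. -/
theorem Fa_eq_omega_sq_mul_Fb [CharP R 5] (ω b d₁ d₂ τ : R) (hω : ω^2 + ω + 1 = 0) :
    Fa (ω*b) b d₁ d₂ τ = ω^2 * Fb (ω*b) b d₁ d₂ τ := by
  have h5 : (5 : R) = 0 := CharP.cast_eq_zero R 5
  have h := Fa_sub_omega_sq_Fb_int ω b d₁ d₂ τ
  rw [hω, mul_zero, zero_add, h5, zero_mul] at h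
  exact sub_eq_zero.mp h

/-- LEMMA ISO8 (b): on an eigenline the second satellite equation factors as
`F_b(ωb,b) = b·(4b⁴ − 2τb + E_b(δ))`, `E_b(δ) = (d₁+3d₂)ω + (3d₁+2d₂)` (any commutative ring with
`ω² + ω + 1 = 0`). -/
theorem Fb_on_eigenline (ω b d₁ d₂ τ : R) (hω : ω^2 + ω + 1 = 0) :
    Fb (ω*b) b d₁ d₂ τ = b * (4*b^4 - 2*τ*b + ((d₁ + 3*d₂)*ω + (3*d₁ + 2*d₂))) := by
  rw [Fb_on_eigenline_int, hω, mul_zero, add_zero]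

/-- LEMMA ISO8 (c): in characteristic `5` a point `(ωb, b)` of an eigenline lies on the satellite scheme
(`F_a = F_b = 0`) as soon as `b·(4b⁴ − 2τb + E_b(δ)) = 0` — for every `(τ, δ)`. -/
theorem on_satellite_scheme_of_quartic [CharP R 5] (ω b d₁ d₂ τ : R) (hω : ω^2 + ω + 1 = 0)
    (hq : b * (4*b^4 - 2*τ*b + ((d₁ + 3*d₂)*ω + (3*d₁ + 2*d₂))) = 0) :
    Fa (ω*b) b d₁ d₂ τ = 0 ∧ Fb (ω*b) b d₁ d₂ τ = 0 := by
  have hb : Fb (ω*b) b d₁ d₂ τ = 0 := by rw [Fb_on_eigenline ω b d₁ d₂ τ hω]; exact hq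
  refine ⟨?_, hb⟩
  rw [Fa_eq_omega_sq_mul_Fb ω b d₁ d₂ τ hω, hb, mul_zero]

/-- Converse of (c): a point `(ωb, b)` of the satellite scheme satisfies the quartic condition. -/
theorem quartic_of_on_satellite_scheme (ω b d₁ d₂ τ : R) (hω : ω^2 + ω + 1 = 0)
    (hb : Fb (ω*b) b d₁ d₂ τ = 0) :
    b * (4*b^4 - 2*τ*b + ((d₁ + 3*d₂)*ω + (3*d₁ + 2*d₂))) = 0 := by
  rw [← Fb_on_eigenline ω b d₁ d₂ τ hω]; exact hb

end Summit.HodgeConjecture.HodgeConjecture.Theorems.SoloBlindE13Isotropic
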